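import Literature.AlgebraicGeometry.ModuliOfAbelianVarieties.SiegelFamilyNoetherLefschetzTwistedProduct
import Literature.Geometry.Kaehler.ComplexTorusTwistedProductIsomorphismLift
import Literature.Geometry.Kaehler.ComplexTorusTwistedProductSwap
import HarnessLib

/-!
# The fibres of Debarre's morphism `𝒫_{g,δ}` in `𝒜_g = Sp_{2g}(ℤ)∖𝔥_g`: isomorphic data give `Sp_{2g}(ℤ)`-equivalent
# Siegel points, and isomorphic triples come from isomorphic data (Iribar López 2024, Def. 4; Auffarth 2016, Thm. 3.5)

Layer `Literature/AlgebraicGeometry/ModuliOfAbelianVarieties`, namespace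
`Literature.AlgebraicGeometry.ModuliOfAbelianVarieties.SiegelModuli`; lane `lit-hodgefound` (Track 2 foundations
library, Layer A4), seat `lit-hodgefound-skel-4` (gen 27), row **A4-77**, FILE J (the `𝒜_g`-reading of the row).
Sequel of the two Kähler-layer files of the row — `ComplexTorusTwistedProductFunctorial.lean` (FILE H: polarised
isomorphisms `α`, `β` of the factors descend to `((Y × Z)/graph(p), θ_p) ⥲ ((Y' × Z')/graph(β|_K p α|_K⁻¹), θ)`) and
`ComplexTorusTwistedProductIsomorphismLift.lean` (FILE I: conversely an isomorphism of the triples comes from such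
`α`, `β`) — and of row A4-76 FILE C `SiegelFamilyNoetherLefschetzTwistedProduct.lean` (the twisted product is
isomorphic to a member `(X_W, E_W)` of the principal Siegel family) and row A4-74 FILE 1 `SiegelFamilyProductLoci.lean`
(`exists_isPolarizedIso_prinPeriod_iff_exists_smul`: `(X_W, E_W) ≅ (X_{W'}, E_{W'})` iff `W' ∈ Sp_{2g}(ℤ) · W`,
Lange Prop. 3.1.4).  Everything is consumed BY NAME; theorems only.

## Sources, verbatim

A. Iribar López, *Noether–Lefschetz cycles on the moduli space of abelian varieties*, Forum Math. Pi (2026), held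
text `paper:arxiv-2411.09910`, §2.2 Def. 4 (p. 8 L1–L17):

> "define the morphism `𝒫_{g,δ} : 𝒜^{lev}_{u,δ} × 𝒜^{lev}_{g−u,δ̃} → 𝒜_g` sending the pair
> `((Y, θ_Y, f_Y), (Z, θ_Z, f_Z))` to `((Y × Z)/graph(f_Z ∘ r ∘ f_Y⁻¹), θ_{f_Z ∘ r ∘ f_Y⁻¹})` […]. The symplectic
> group of `K(δ)` acts on `𝒜^{lev}_{u,δ} × 𝒜^{lev}_{g−u,δ̃}` and `𝒫_{g,δ}` is invariant under this action. Let
> `𝒜'_{u,g−u,δ}` be the quotient by this action. It parametrizes triplets `(X, Y, Z, θ)` […]."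

R. Auffarth, *On a numerical characterization of non-simple principally polarized abelian varieties*, Math. Z. 282
(2016), held text `paper:arxiv-1507.08618`, §3 (p. 9 L58–L62, p. 10 L1):

> "**Theorem 3.5.** If `u < n/2`, the morphism `Φ_{u,n−u}(D)` induces an isomorphism
> `(𝒜_u(D) × 𝒜_{n−u}(D̃))/Sp(D) → 𝒜^D_{u,n−u}`. […] if `h ∈ Sp(D)`, `(εhεg)⁻¹εhf = g⁻¹εf` and so this action
> obviously permutes the fibers of `Φ_{u,n−u}(D)`."

## What is proved (theorems only; no definition, no named fact, net debt `0`)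

In the tree's reading `𝒜_g = Sp_{2g}(ℤ)∖𝔥_g` (a principally polarised torus ↦ the `Sp_{2g}(ℤ)`-orbit of its Siegel
points `W ∈ 𝔥_g`, `(X_W, E_W) = (ComplexTorus (prinPeriod W), prinForm W)`; isomorphic p.p. tori have
`Sp_{2g}(ℤ)`-equivalent points, `exists_isPolarizedIso_prinPeriod_iff_exists_smul`):

* §1 **`𝒫_{g,δ}` is well defined on isomorphism classes and `Sp(K(δ))`-invariant, as a map to `𝒜_g`**
  (`exists_smul_eq_of_isPolarizedIso_factors`): if `W`, `W'` are Siegel points of the twisted products of data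
  `(Y, Z, p)` and `(Y', Z', β|_K p α|_K⁻¹)` related by polarised isomorphisms `α`, `β` of the factors, then
  `W' = M · W` for some `M ∈ Sp_{2g}(ℤ)`; in particular (`exists_siegelPoints_smul_eq_of_polarized_automorphisms`)
  for polarised automorphisms `α ∈ Aut(Y, θ_Y)`, `β ∈ Aut(Z, θ_Z)` the twisted products of `p` and of `β p α⁻¹`
  have `Sp_{2g}(ℤ)`-equivalent Siegel points;
* §2 **conversely** (`exists_isPolarizedIso_factors_of_isPolarizedIso_siegelPoints`): if the Siegel members
  `(X_W, E_W)`, `(X_{W'}, E_{W'})` of two twisted products are isomorphic by an isomorphism of polarised tori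
  respecting the complementary pairs (the images of `Y × 0`, `0 × Z`), the data are isomorphic:
  `p' ∘ α|_K = β|_K ∘ p` for polarised isomorphisms `α`, `β` of the factors — "parametrizes triplets".
* §3 **switching the factors** (Auffarth Thm. 3.5, the `ℤ/2ℤ` of the case `u = n/2`: "where `ℤ/2ℤ` interchanges
  the factors […] switching the two factors leaves the fibers invariant"; rider of gen 27 on FILE K
  `ComplexTorusTwistedProductSwap.lean`): Siegel points of the twisted products of `(Y, Z, e)` and of
  `(Z, Y, e⁻¹)` are `Sp_{2g}(ℤ)`-equivalent (`exists_smul_eq_of_isPolarizedIso_swap`), and for Riemann forms and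
  an antisymplectic `e` both have Siegel points (`exists_siegelPoints_smul_eq_swap`) — the unordered pair
  `{(Y, θ_Y), (Z, θ_Z)}` with `e` determines the point of `𝒜_g`.

## References

* [IribarLopez2024NoetherLefschetzCycles] A. Iribar López, *Noether–Lefschetz cycles on the moduli space of abelian
  varieties*, Forum Math. Pi (2026), arXiv:2411.09910, §2.2 Lemma 10 (p. 7), Def. 4 (p. 8).
* [Auffarth2016NonSimplePPAV] R. Auffarth, *On a numerical characterization of non-simple principally polarized
  abelian varieties*, Math. Z. 282 (2016) 731–746, arXiv:1507.08618, §3 Thm. 3.5 (pp. 9–10).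
* [Lange2023AbelianVarietiesComplex] H. Lange, *Abelian Varieties over the Complex Numbers* (2023), §3.1.1 Thm. 3.1.2
  (p. 158), §3.1.2 Prop. 3.1.4 (pp. 159–160), §8.1 (the moduli space `𝒜_g`).
-/

noncomputable section

open Matrix Module Function Set

namespace Literature.AlgebraicGeometry.ModuliOfAbelianVarieties

namespace SiegelModuli

open Literature.NumberTheory.Automorphic (siegelUpperHalfSpace)
open Literature.NumberTheory.ModularForms.SiegelUpperHalfSpace
open Literature.Geometry.Kaehler Literature.Geometry.Kaehler.ComplexTorus

variable {g : ℕ}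

variable {ι₁ ι₂ ι₁' ι₂' : Type*} [Fintype ι₁] [Fintype ι₂] [Fintype ι₁'] [Fintype ι₂']
  [DecidableEq ι₁] [DecidableEq ι₂] [DecidableEq ι₁'] [DecidableEq ι₂']
  {E₁ E₂ E₁' E₂' : Type*} [NormedAddCommGroup E₁] [NormedSpace ℂ E₁] [NormedAddCommGroup E₂] [NormedSpace ℂ E₂]
  [NormedAddCommGroup E₁'] [NormedSpace ℂ E₁'] [NormedAddCommGroup E₂'] [NormedSpace ℂ E₂']
  {Φ₁ : (ι₁ → ℝ) ≃L[ℝ] E₁} {Φ₂ : (ι₂ → ℝ) ≃L[ℝ] E₂} {Φ₁' : (ι₁' → ℝ) ≃L[ℝ] E₁'} {Φ₂' : (ι₂' → ℝ) ≃L[ℝ] E₂'}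
  {ω₁ : E₁ [⋀^Fin 2]→L[ℝ] ℝ} {ω₂ : E₂ [⋀^Fin 2]→L[ℝ] ℝ} {ω₁' : E₁' [⋀^Fin 2]→L[ℝ] ℝ} {ω₂' : E₂' [⋀^Fin 2]→L[ℝ] ℝ}
  {K₁ : AddSubgroup (ComplexTorus Φ₁)} {K₂ : AddSubgroup (ComplexTorus Φ₂)}
  {K₁' : AddSubgroup (ComplexTorus Φ₁')} {K₂' : AddSubgroup (ComplexTorus Φ₂')}

/-- `e⁻¹(e(S)) = S` for subgroups. [folklore] -/
private theorem map_map_symm_DMF {G H : Type*} [AddGroup G] [AddGroup H] (e : G ≃+ H) (S : AddSubgroup G) :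
    (S.map e.toAddMonoidHom).map e.symm.toAddMonoidHom = S := by
  ext x
  constructor
  · rintro ⟨y, ⟨z, hz, rfl⟩, rfl⟩
    simpa using hz
  · intro hx
    exact ⟨e x, ⟨x, hx, rfl⟩, e.symm_apply_apply x⟩

/-! ## §1 `𝒫_{g,δ}` is well defined on isomorphism classes, as a map to `𝒜_g = Sp_{2g}(ℤ)∖𝔥_g` -/

section WellDefined

variable {α : ComplexTorus Φ₁ ≃+ ComplexTorus Φ₁'} {β : ComplexTorus Φ₂ ≃+ ComplexTorus Φ₂'}
  (hα : IsPolarizedIso Φ₁ ω₁ Φ₁' ω₁' α) (hβ : IsPolarizedIso Φ₂ ω₂ Φ₂' ω₂' β)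
  {e₁ : K₁ ≃+ K₁'} {e₂ : K₂ ≃+ K₂'}
  (he₁ : ∀ s, (e₁ s : ComplexTorus Φ₁') = α s) (he₂ : ∀ s, (e₂ s : ComplexTorus Φ₂') = β s)
  (p : K₁ →+ K₂) [Finite (graphSubgroup K₁ K₂ p)]
  [Finite (graphSubgroup K₁' K₂' (e₂.toAddMonoidHom.comp (p.comp e₁.symm.toAddMonoidHom)))]

include hα hβ he₁ he₂ in
/-- **Def. 4: `𝒫_{g,δ}` is well defined on isomorphism classes of the data (and hence invariant under
`Sp(K(δ))`), read in `𝒜_g = Sp_{2g}(ℤ)∖𝔥_g`.**  Let `α : (Y, ω₁) ⥲ (Y', ω₁')`, `β : (Z, ω₂) ⥲ (Z', ω₂')` be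
isomorphisms of polarised tori with restrictions `e₁ : K₁ ≃ K₁'`, `e₂ : K₂ ≃ K₂'`, `p : K₁ → K₂`, and
`p' = e₂ ∘ p ∘ e₁⁻¹`.  If `W, W' ∈ 𝔥_g` are Siegel points of the two twisted products — isomorphisms of polarised tori
`((Y × Z)/graph(p), ω₁ ⊞ ω₂) ⥲ (X_W, E_W)` and `((Y' × Z')/graph(p'), ω₁' ⊞ ω₂') ⥲ (X_{W'}, E_{W'})` — then
`W' = M · W` for some `M ∈ Sp_{2g}(ℤ)`: the two twisted products define THE SAME POINT of `𝒜_g` (FILE H's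
isomorphism composed with Prop. 3.1.4). [cite: IribarLopez2024NoetherLefschetzCycles, §2.2 Def. 4 (p. 8: "`𝒫_{g,δ}` is invariant under this action")] [cite: Auffarth2016NonSimplePPAV, §3 Thm. 3.5 (proof: "this action obviously permutes the fibers")] [cite: Lange2023AbelianVarietiesComplex, §3.1.2 Prop. 3.1.4 (pp. 159–160)] -/
theorem exists_smul_eq_of_isPolarizedIso_factors {W W' : siegelUpperHalfSpace g}
    {hW : ComplexTorus (quotientByPeriod (prodPeriod Φ₁ Φ₂) (graphSubgroup K₁ K₂ p)) ≃+
      ComplexTorus (prinPeriod W : (Fin g ⊕ Fin g → ℝ) ≃L[ℝ] (Fin g → ℂ))}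
    (hhW : IsPolarizedIso (quotientByPeriod (prodPeriod Φ₁ Φ₂) (graphSubgroup K₁ K₂ p)) (prodForm ω₁ ω₂)
      (prinPeriod W : (Fin g ⊕ Fin g → ℝ) ≃L[ℝ] (Fin g → ℂ)) (prinForm W) hW)
    {hW' : ComplexTorus (quotientByPeriod (prodPeriod Φ₁' Φ₂')
        (graphSubgroup K₁' K₂' (e₂.toAddMonoidHom.comp (p.comp e₁.symm.toAddMonoidHom)))) ≃+
      ComplexTorus (prinPeriod W' : (Fin g ⊕ Fin g → ℝ) ≃L[ℝ] (Fin g → ℂ))}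
    (hhW' : IsPolarizedIso (quotientByPeriod (prodPeriod Φ₁' Φ₂')
        (graphSubgroup K₁' K₂' (e₂.toAddMonoidHom.comp (p.comp e₁.symm.toAddMonoidHom)))) (prodForm ω₁' ω₂')
      (prinPeriod W' : (Fin g ⊕ Fin g → ℝ) ≃L[ℝ] (Fin g → ℂ)) (prinForm W') hW') :
    ∃ M : symplecticLatticeGroup (fun _ : Fin g ↦ 1), W' = gDHom (fun _ : Fin g ↦ 1) principalType_pos M • W := by
  obtain ⟨-, k, -, -, hk, -⟩ := exists_isPolarizedIso_quotientBy_graphSubgroup_conj hα hβ he₁ he₂ p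
  exact (exists_isPolarizedIso_prinPeriod_iff_exists_smul W W').1
    ⟨(hW.symm.trans k).trans hW', (hhW.symm.trans hk).trans hhW'⟩

end WellDefined

section Aut

variable {G₁ : Matrix ι₁ ι₁ ℤ} {G₂ : Matrix ι₂ ι₂ ℤ}
  (hω₁ : IsRiemannForm Φ₁ ω₁) (hω₂ : IsRiemannForm Φ₂ ω₂)
  (hG₁ : G₁.map (Int.cast : ℤ → ℝ) = latticeGram Φ₁ ω₁) (hG₂ : G₂.map (Int.cast : ℤ → ℝ) = latticeGram Φ₂ ω₂)
  {α : ComplexTorus Φ₁ ≃+ ComplexTorus Φ₁} {β : ComplexTorus Φ₂ ≃+ ComplexTorus Φ₂}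
  (hα : IsPolarizedIso Φ₁ ω₁ Φ₁ ω₁ α) (hβ : IsPolarizedIso Φ₂ ω₂ Φ₂ ω₂ β)
  {p : kerPhiH Φ₁ G₁ →+ kerPhiH Φ₂ G₂} (hp : Bijective p) (ha : IsAntisymplectic ω₁ ω₂ p)

include hω₁ hω₂ hG₁ hG₂ hα hβ hp ha in
/-- **The `Sp(K(δ))`-invariance of `𝒫_{g,δ}` in `𝒜_g`, for fixed factors**: for polarised tori `(Y, ω₁)`, `(Z, ω₂)`
(Riemann forms, integer Gram matrices, `rk Λ_Y + rk Λ_Z = 2g`), an antisymplectic isomorphism `p : K(L₁) ≅ K(L₂)`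
and polarised automorphisms `α ∈ Aut(Y, θ_Y)`, `β ∈ Aut(Z, θ_Z)`: the twisted products of `p` and of
`β|_K p α|_K⁻¹` have Siegel points `W`, `W' ∈ 𝔥_g` (A4-76 FILE C), and any such are `Sp_{2g}(ℤ)`-EQUIVALENT — the
`Aut(Z, θ_Z) × Aut(Y, θ_Y)`-orbit of `p` maps to one point of `𝒜_g` ("this action obviously permutes the fibers").
[cite: IribarLopez2024NoetherLefschetzCycles, §2.2 Def. 4 (p. 8)] [cite: Auffarth2016NonSimplePPAV, §3 Thm. 3.5 (proof, p. 10)] [cite: Lange2023AbelianVarietiesComplex, §3.1.1 Thm. 3.1.2 (p. 158) and §3.1.2 Prop. 3.1.4 (pp. 159–160)] -/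
theorem exists_siegelPoints_smul_eq_of_polarized_automorphisms (hg : Fintype.card ι₁ + Fintype.card ι₂ = 2 * g) :
    ∃ (e₁ : kerPhiH Φ₁ G₁ ≃+ kerPhiH Φ₁ G₁) (e₂ : kerPhiH Φ₂ G₂ ≃+ kerPhiH Φ₂ G₂)
      (_ : ∀ s, (e₁ s : ComplexTorus Φ₁) = α s) (_ : ∀ s, (e₂ s : ComplexTorus Φ₂) = β s)
      (_ : Finite (graphSubgroup (kerPhiH Φ₁ G₁) (kerPhiH Φ₂ G₂) p))
      (_ : Finite (graphSubgroup (kerPhiH Φ₁ G₁) (kerPhiH Φ₂ G₂) (e₂.toAddMonoidHom.comp (p.comp e₁.symm.toAddMonoidHom))))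
      (W W' : siegelUpperHalfSpace g)
      (hW : ComplexTorus (quotientByPeriod (prodPeriod Φ₁ Φ₂) (graphSubgroup (kerPhiH Φ₁ G₁) (kerPhiH Φ₂ G₂) p)) ≃+
        ComplexTorus (prinPeriod W : (Fin g ⊕ Fin g → ℝ) ≃L[ℝ] (Fin g → ℂ)))
      (hW' : ComplexTorus (quotientByPeriod (prodPeriod Φ₁ Φ₂) (graphSubgroup (kerPhiH Φ₁ G₁) (kerPhiH Φ₂ G₂)
          (e₂.toAddMonoidHom.comp (p.comp e₁.symm.toAddMonoidHom)))) ≃+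
        ComplexTorus (prinPeriod W' : (Fin g ⊕ Fin g → ℝ) ≃L[ℝ] (Fin g → ℂ))),
      IsPolarizedIso (quotientByPeriod (prodPeriod Φ₁ Φ₂) (graphSubgroup (kerPhiH Φ₁ G₁) (kerPhiH Φ₂ G₂) p))
          (prodForm ω₁ ω₂) (prinPeriod W : (Fin g ⊕ Fin g → ℝ) ≃L[ℝ] (Fin g → ℂ)) (prinForm W) hW ∧
      IsPolarizedIso (quotientByPeriod (prodPeriod Φ₁ Φ₂) (graphSubgroup (kerPhiH Φ₁ G₁) (kerPhiH Φ₂ G₂)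
          (e₂.toAddMonoidHom.comp (p.comp e₁.symm.toAddMonoidHom)))) (prodForm ω₁ ω₂)
          (prinPeriod W' : (Fin g ⊕ Fin g → ℝ) ≃L[ℝ] (Fin g → ℂ)) (prinForm W') hW' ∧
      (∀ (W₁ W₁' : siegelUpperHalfSpace g)
        (h₁ : ComplexTorus (quotientByPeriod (prodPeriod Φ₁ Φ₂) (graphSubgroup (kerPhiH Φ₁ G₁) (kerPhiH Φ₂ G₂) p)) ≃+
          ComplexTorus (prinPeriod W₁ : (Fin g ⊕ Fin g → ℝ) ≃L[ℝ] (Fin g → ℂ)))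
        (h₁' : ComplexTorus (quotientByPeriod (prodPeriod Φ₁ Φ₂) (graphSubgroup (kerPhiH Φ₁ G₁) (kerPhiH Φ₂ G₂)
            (e₂.toAddMonoidHom.comp (p.comp e₁.symm.toAddMonoidHom)))) ≃+
          ComplexTorus (prinPeriod W₁' : (Fin g ⊕ Fin g → ℝ) ≃L[ℝ] (Fin g → ℂ))),
        IsPolarizedIso (quotientByPeriod (prodPeriod Φ₁ Φ₂) (graphSubgroup (kerPhiH Φ₁ G₁) (kerPhiH Φ₂ G₂) p))
            (prodForm ω₁ ω₂) (prinPeriod W₁ : (Fin g ⊕ Fin g → ℝ) ≃L[ℝ] (Fin g → ℂ)) (prinForm W₁) h₁ →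
        IsPolarizedIso (quotientByPeriod (prodPeriod Φ₁ Φ₂) (graphSubgroup (kerPhiH Φ₁ G₁) (kerPhiH Φ₂ G₂)
            (e₂.toAddMonoidHom.comp (p.comp e₁.symm.toAddMonoidHom)))) (prodForm ω₁ ω₂)
            (prinPeriod W₁' : (Fin g ⊕ Fin g → ℝ) ≃L[ℝ] (Fin g → ℂ)) (prinForm W₁') h₁' →
        ∃ M : symplecticLatticeGroup (fun _ : Fin g ↦ 1), W₁' = gDHom (fun _ : Fin g ↦ 1) principalType_pos M • W₁) := by
  obtain ⟨e₁, e₂, he₁, he₂, hp', ha', i1, i2, -, -, -, -, -, -, -, -⟩ :=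
    exists_isPolarizedIso_quotientBy_graphSubgroup_of_polarized_automorphisms hω₁ hω₂ hG₁ hG₂ hα hβ hp ha
  haveI := i1
  haveI := i2
  obtain ⟨W, hW, hhW⟩ := exists_isPolarizedIso_prinPeriod_quotientBy_graphSubgroup hω₁ hω₂ hG₁ hG₂ hp ha hg
  obtain ⟨W', hW', hhW'⟩ := exists_isPolarizedIso_prinPeriod_quotientBy_graphSubgroup hω₁ hω₂ hG₁ hG₂ hp' ha' hg
  exact ⟨e₁, e₂, he₁, he₂, i1, i2, W, W', hW, hW', hhW, hhW',
    fun W₁ W₁' h₁ h₁' hh₁ hh₁' ↦ exists_smul_eq_of_isPolarizedIso_factors hα hβ he₁ he₂ p hh₁ hh₁'⟩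

end Aut

/-! ## §2 Conversely: isomorphic triples in the Siegel family come from isomorphic data -/

section Converse

variable {p : K₁ →+ K₂} {p' : K₁' →+ K₂'} [Finite (graphSubgroup K₁ K₂ p)] [Finite (graphSubgroup K₁' K₂' p')]

/-- **"`𝒜'_{u,g−u,δ}` parametrizes triplets", in the Siegel family.**  Let `(Y × Z)/graph(p) ≅ (X_W, E_W)` and
`(Y' × Z')/graph(p') ≅ (X_{W'}, E_{W'})` (polarised isomorphisms `h_W`, `h_{W'}`; `p`, `p'` bijective with finite
graphs) and suppose `(X_W, E_W) ⥲ (X_{W'}, E_{W'})` by an isomorphism of polarised tori `k₀` carrying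
`h_W(π(Y × 0))` onto `h_{W'}(π'(Y' × 0))` and `h_W(π(0 × Z))` onto `h_{W'}(π'(0 × Z'))` — an isomorphism of the TRIPLES
`(X_W ⊃ Y, Z) ≅ (X_{W'} ⊃ Y', Z')`.  Then the data are isomorphic: there are isomorphisms of polarised tori
`α : (Y, ω₁) ⥲ (Y', ω₁')`, `β : (Z, ω₂) ⥲ (Z', ω₂')` with `α(K₁) = K₁'`, `β(K₂) = K₂'` and `p' ∘ α|_K = β|_K ∘ p`
(FILE I composed with `h_W`, `k₀`, `h_{W'}⁻¹`). [cite: IribarLopez2024NoetherLefschetzCycles, §2.2 Def. 4 (p. 8: "parametrizes triplets `(X, Y, Z, θ)`")] [cite: Auffarth2016NonSimplePPAV, §3 Thm. 3.5 (proof, p. 10)] [cite: Lange2023AbelianVarietiesComplex, §3.1.2 Prop. 3.1.4 (pp. 159–160)] -/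
theorem exists_isPolarizedIso_factors_of_isPolarizedIso_siegelPoints (hp : Bijective p) (hp' : Bijective p')
    {W W' : siegelUpperHalfSpace g}
    {hW : ComplexTorus (quotientByPeriod (prodPeriod Φ₁ Φ₂) (graphSubgroup K₁ K₂ p)) ≃+
      ComplexTorus (prinPeriod W : (Fin g ⊕ Fin g → ℝ) ≃L[ℝ] (Fin g → ℂ))}
    (hhW : IsPolarizedIso (quotientByPeriod (prodPeriod Φ₁ Φ₂) (graphSubgroup K₁ K₂ p)) (prodForm ω₁ ω₂)
      (prinPeriod W : (Fin g ⊕ Fin g → ℝ) ≃L[ℝ] (Fin g → ℂ)) (prinForm W) hW)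
    {hW' : ComplexTorus (quotientByPeriod (prodPeriod Φ₁' Φ₂') (graphSubgroup K₁' K₂' p')) ≃+
      ComplexTorus (prinPeriod W' : (Fin g ⊕ Fin g → ℝ) ≃L[ℝ] (Fin g → ℂ))}
    (hhW' : IsPolarizedIso (quotientByPeriod (prodPeriod Φ₁' Φ₂') (graphSubgroup K₁' K₂' p')) (prodForm ω₁' ω₂')
      (prinPeriod W' : (Fin g ⊕ Fin g → ℝ) ≃L[ℝ] (Fin g → ℂ)) (prinForm W') hW')
    {k₀ : ComplexTorus (prinPeriod W : (Fin g ⊕ Fin g → ℝ) ≃L[ℝ] (Fin g → ℂ)) ≃+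
      ComplexTorus (prinPeriod W' : (Fin g ⊕ Fin g → ℝ) ≃L[ℝ] (Fin g → ℂ))}
    (hk₀ : IsPolarizedIso (prinPeriod W : (Fin g ⊕ Fin g → ℝ) ≃L[ℝ] (Fin g → ℂ)) (prinForm W)
      (prinPeriod W' : (Fin g ⊕ Fin g → ℝ) ≃L[ℝ] (Fin g → ℂ)) (prinForm W') k₀)
    (hY : (((subtorus (prodPeriod Φ₁ Φ₂) (fstSubspace : Submodule ℝ (ι₁ ⊕ ι₂ → ℝ))).map
        (mapMatrixHom (prodPeriod Φ₁ Φ₂) (quotientByPeriod (prodPeriod Φ₁ Φ₂) (graphSubgroup K₁ K₂ p))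
          (quotientMatrix (prodPeriod Φ₁ Φ₂) (graphSubgroup K₁ K₂ p)))).map hW.toAddMonoidHom).map k₀.toAddMonoidHom =
      ((subtorus (prodPeriod Φ₁' Φ₂') (fstSubspace : Submodule ℝ (ι₁' ⊕ ι₂' → ℝ))).map
        (mapMatrixHom (prodPeriod Φ₁' Φ₂') (quotientByPeriod (prodPeriod Φ₁' Φ₂') (graphSubgroup K₁' K₂' p'))
          (quotientMatrix (prodPeriod Φ₁' Φ₂') (graphSubgroup K₁' K₂' p')))).map hW'.toAddMonoidHom)
    (hZ : (((subtorus (prodPeriod Φ₁ Φ₂) (sndSubspace : Submodule ℝ (ι₁ ⊕ ι₂ → ℝ))).map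
        (mapMatrixHom (prodPeriod Φ₁ Φ₂) (quotientByPeriod (prodPeriod Φ₁ Φ₂) (graphSubgroup K₁ K₂ p))
          (quotientMatrix (prodPeriod Φ₁ Φ₂) (graphSubgroup K₁ K₂ p)))).map hW.toAddMonoidHom).map k₀.toAddMonoidHom =
      ((subtorus (prodPeriod Φ₁' Φ₂') (sndSubspace : Submodule ℝ (ι₁' ⊕ ι₂' → ℝ))).map
        (mapMatrixHom (prodPeriod Φ₁' Φ₂') (quotientByPeriod (prodPeriod Φ₁' Φ₂') (graphSubgroup K₁' K₂' p'))
          (quotientMatrix (prodPeriod Φ₁' Φ₂') (graphSubgroup K₁' K₂' p')))).map hW'.toAddMonoidHom) :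
    ∃ (α : ComplexTorus Φ₁ ≃+ ComplexTorus Φ₁') (β : ComplexTorus Φ₂ ≃+ ComplexTorus Φ₂') (e₁ : K₁ ≃+ K₁')
      (e₂ : K₂ ≃+ K₂'), IsPolarizedIso Φ₁ ω₁ Φ₁' ω₁' α ∧ IsPolarizedIso Φ₂ ω₂ Φ₂' ω₂' β ∧
      (∀ s, (e₁ s : ComplexTorus Φ₁') = α s) ∧ (∀ s, (e₂ s : ComplexTorus Φ₂') = β s) ∧
      ∀ s, p' (e₁ s) = e₂ (p s) := by
  -- the isomorphism of the twisted products `k = h_{W'}⁻¹ ∘ k₀ ∘ h_W`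
  have hk : IsPolarizedIso (quotientByPeriod (prodPeriod Φ₁ Φ₂) (graphSubgroup K₁ K₂ p)) (prodForm ω₁ ω₂)
      (quotientByPeriod (prodPeriod Φ₁' Φ₂') (graphSubgroup K₁' K₂' p')) (prodForm ω₁' ω₂')
      ((hW.trans k₀).trans hW'.symm) := (hhW.trans hk₀).trans hhW'.symm
  have hmap : ∀ S : AddSubgroup (ComplexTorus (quotientByPeriod (prodPeriod Φ₁ Φ₂) (graphSubgroup K₁ K₂ p))),
      S.map ((hW.trans k₀).trans hW'.symm).toAddMonoidHom =
        ((S.map hW.toAddMonoidHom).map k₀.toAddMonoidHom).map hW'.symm.toAddMonoidHom := fun S ↦ by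
    rw [AddSubgroup.map_map, AddSubgroup.map_map]
    rfl
  refine (exists_isPolarizedIso_quotientBy_graphSubgroup_iff hp hp').2 ⟨(hW.trans k₀).trans hW'.symm, hk, ?_, ?_⟩
  · rw [hmap, hY, map_map_symm_DMF]
  · rw [hmap, hZ, map_map_symm_DMF]

end Converse

/-! ## §3 Switching the factors: the twisted products of `(Y, Z, e)` and `(Z, Y, e⁻¹)` are the same point of `𝒜_g`
(rider, gen 27) -/

section Swap

/-- **Auffarth 2016, Thm. 3.5 ("`ℤ/2ℤ` interchanges the factors"), read in `𝒜_g = Sp_{2g}(ℤ)∖𝔥_g`.**  For a group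
isomorphism `e : K₁ ≅ K₂` (subgroups of `Y`, `Z`, finite graphs): if `W, W' ∈ 𝔥_g` are Siegel points of the twisted
products `((Y × Z)/graph(e), ω₁ ⊞ ω₂)` and `((Z × Y)/graph(e⁻¹), ω₂ ⊞ ω₁)` (isomorphisms of polarised tori onto
`(X_W, E_W)`, `(X_{W'}, E_{W'})`), then `W' = M · W` for some `M ∈ Sp_{2g}(ℤ)` (FILE K's exchange isomorphism
`exists_isPolarizedIso_quotientBy_graphSubgroup_swap` composed with Prop. 3.1.4) — "switching the two factors
leaves the fibers invariant". [cite: Auffarth2016NonSimplePPAV, §3 Thm. 3.5 (p. 9: "where `ℤ/2ℤ` interchanges the factors"; proof p. 10)] [cite: IribarLopez2024NoetherLefschetzCycles, §2.2 Remark 11 (p. 8: "if `g` is even and `u = g/2`, then `δ̃ = δ`, and this has to be taken into account")] [cite: Lange2023AbelianVarietiesComplex, §3.1.2 Prop. 3.1.4 (pp. 159–160)] -/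
theorem exists_smul_eq_of_isPolarizedIso_swap (e : K₁ ≃+ K₂) [Finite (graphSubgroup K₁ K₂ e.toAddMonoidHom)]
    [Finite (graphSubgroup K₂ K₁ e.symm.toAddMonoidHom)] {W W' : siegelUpperHalfSpace g}
    {hW : ComplexTorus (quotientByPeriod (prodPeriod Φ₁ Φ₂) (graphSubgroup K₁ K₂ e.toAddMonoidHom)) ≃+
      ComplexTorus (prinPeriod W : (Fin g ⊕ Fin g → ℝ) ≃L[ℝ] (Fin g → ℂ))}
    (hhW : IsPolarizedIso (quotientByPeriod (prodPeriod Φ₁ Φ₂) (graphSubgroup K₁ K₂ e.toAddMonoidHom))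
      (prodForm ω₁ ω₂) (prinPeriod W : (Fin g ⊕ Fin g → ℝ) ≃L[ℝ] (Fin g → ℂ)) (prinForm W) hW)
    {hW' : ComplexTorus (quotientByPeriod (prodPeriod Φ₂ Φ₁) (graphSubgroup K₂ K₁ e.symm.toAddMonoidHom)) ≃+
      ComplexTorus (prinPeriod W' : (Fin g ⊕ Fin g → ℝ) ≃L[ℝ] (Fin g → ℂ))}
    (hhW' : IsPolarizedIso (quotientByPeriod (prodPeriod Φ₂ Φ₁) (graphSubgroup K₂ K₁ e.symm.toAddMonoidHom))
      (prodForm ω₂ ω₁) (prinPeriod W' : (Fin g ⊕ Fin g → ℝ) ≃L[ℝ] (Fin g → ℂ)) (prinForm W') hW') :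
    ∃ M : symplecticLatticeGroup (fun _ : Fin g ↦ 1), W' = gDHom (fun _ : Fin g ↦ 1) principalType_pos M • W := by
  obtain ⟨-, k, -, -, hk, -⟩ := exists_isPolarizedIso_quotientBy_graphSubgroup_swap ω₁ ω₂ e
  exact (exists_isPolarizedIso_prinPeriod_iff_exists_smul W W').1
    ⟨(hW.symm.trans k).trans hW', (hhW.symm.trans hk).trans hhW'⟩

variable {G₁ : Matrix ι₁ ι₁ ℤ} {G₂ : Matrix ι₂ ι₂ ℤ}
  (hω₁ : IsRiemannForm Φ₁ ω₁) (hω₂ : IsRiemannForm Φ₂ ω₂)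
  (hG₁ : G₁.map (Int.cast : ℤ → ℝ) = latticeGram Φ₁ ω₁) (hG₂ : G₂.map (Int.cast : ℤ → ℝ) = latticeGram Φ₂ ω₂)
  {e : kerPhiH Φ₁ G₁ ≃+ kerPhiH Φ₂ G₂} (ha : IsAntisymplectic ω₁ ω₂ e.toAddMonoidHom)

include hω₁ hω₂ hG₁ hG₂ ha in
/-- **Switching the factors of Debarre's construction, in `𝒜_g`.**  For polarised tori `(Y, ω₁)`, `(Z, ω₂)` (Riemann
forms, integer Gram matrices, `rk Λ_Y + rk Λ_Z = 2g`) and an antisymplectic isomorphism `e : K(L₁) ≅ K(L₂)`: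
`e⁻¹` is antisymplectic, the twisted products of `(Y, Z, e)` and of `(Z, Y, e⁻¹)` both have Siegel points `W`,
`W' ∈ 𝔥_g` (row A4-76 FILE C, for `p₁^*ω₁ + p₂^*ω₂` and `p₁^*ω₂ + p₂^*ω₁`), and ANY such are `Sp_{2g}(ℤ)`-equivalent —
both orderings of the pair give the same point of `𝒜_g` ("switching the two factors leaves the fibers invariant";
for `u = g/2`, `δ̃ = δ`, this is the extra `ℤ/2ℤ` in `(𝒜_{n/2}(D) × 𝒜_{n/2}(D))/(ℤ/2ℤ ⋉ Sp(D)) ≅ 𝒜^D_{n/2,n/2}`).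
[cite: Auffarth2016NonSimplePPAV, §3 Thm. 3.5 (pp. 9–10)] [cite: IribarLopez2024NoetherLefschetzCycles, §2.2 Lemma 10, Def. 4 and Remark 11 (pp. 7–8)] [cite: Lange2023AbelianVarietiesComplex, §3.1.1 Thm. 3.1.2 (p. 158) and §3.1.2 Prop. 3.1.4 (pp. 159–160)] -/
theorem exists_siegelPoints_smul_eq_swap (hg : Fintype.card ι₁ + Fintype.card ι₂ = 2 * g) :
    ∃ (_ : IsAntisymplectic ω₂ ω₁ e.symm.toAddMonoidHom)
      (_ : Finite (graphSubgroup (kerPhiH Φ₁ G₁) (kerPhiH Φ₂ G₂) e.toAddMonoidHom))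
      (_ : Finite (graphSubgroup (kerPhiH Φ₂ G₂) (kerPhiH Φ₁ G₁) e.symm.toAddMonoidHom))
      (W W' : siegelUpperHalfSpace g)
      (hW : ComplexTorus (quotientByPeriod (prodPeriod Φ₁ Φ₂)
          (graphSubgroup (kerPhiH Φ₁ G₁) (kerPhiH Φ₂ G₂) e.toAddMonoidHom)) ≃+
        ComplexTorus (prinPeriod W : (Fin g ⊕ Fin g → ℝ) ≃L[ℝ] (Fin g → ℂ)))
      (hW' : ComplexTorus (quotientByPeriod (prodPeriod Φ₂ Φ₁)
          (graphSubgroup (kerPhiH Φ₂ G₂) (kerPhiH Φ₁ G₁) e.symm.toAddMonoidHom)) ≃+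
        ComplexTorus (prinPeriod W' : (Fin g ⊕ Fin g → ℝ) ≃L[ℝ] (Fin g → ℂ))),
      IsPolarizedIso (quotientByPeriod (prodPeriod Φ₁ Φ₂) (graphSubgroup (kerPhiH Φ₁ G₁) (kerPhiH Φ₂ G₂) e.toAddMonoidHom))
          (prodForm ω₁ ω₂) (prinPeriod W : (Fin g ⊕ Fin g → ℝ) ≃L[ℝ] (Fin g → ℂ)) (prinForm W) hW ∧
      IsPolarizedIso (quotientByPeriod (prodPeriod Φ₂ Φ₁)
          (graphSubgroup (kerPhiH Φ₂ G₂) (kerPhiH Φ₁ G₁) e.symm.toAddMonoidHom))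
          (prodForm ω₂ ω₁) (prinPeriod W' : (Fin g ⊕ Fin g → ℝ) ≃L[ℝ] (Fin g → ℂ)) (prinForm W') hW' ∧
      ∀ (W₁ W₁' : siegelUpperHalfSpace g)
        (h₁ : ComplexTorus (quotientByPeriod (prodPeriod Φ₁ Φ₂)
            (graphSubgroup (kerPhiH Φ₁ G₁) (kerPhiH Φ₂ G₂) e.toAddMonoidHom)) ≃+
          ComplexTorus (prinPeriod W₁ : (Fin g ⊕ Fin g → ℝ) ≃L[ℝ] (Fin g → ℂ)))
        (h₁' : ComplexTorus (quotientByPeriod (prodPeriod Φ₂ Φ₁)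
            (graphSubgroup (kerPhiH Φ₂ G₂) (kerPhiH Φ₁ G₁) e.symm.toAddMonoidHom)) ≃+
          ComplexTorus (prinPeriod W₁' : (Fin g ⊕ Fin g → ℝ) ≃L[ℝ] (Fin g → ℂ))),
        IsPolarizedIso (quotientByPeriod (prodPeriod Φ₁ Φ₂)
            (graphSubgroup (kerPhiH Φ₁ G₁) (kerPhiH Φ₂ G₂) e.toAddMonoidHom))
            (prodForm ω₁ ω₂) (prinPeriod W₁ : (Fin g ⊕ Fin g → ℝ) ≃L[ℝ] (Fin g → ℂ)) (prinForm W₁) h₁ →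
        IsPolarizedIso (quotientByPeriod (prodPeriod Φ₂ Φ₁)
            (graphSubgroup (kerPhiH Φ₂ G₂) (kerPhiH Φ₁ G₁) e.symm.toAddMonoidHom))
            (prodForm ω₂ ω₁) (prinPeriod W₁' : (Fin g ⊕ Fin g → ℝ) ≃L[ℝ] (Fin g → ℂ)) (prinForm W₁') h₁' →
        ∃ M : symplecticLatticeGroup (fun _ : Fin g ↦ 1), W₁' = gDHom (fun _ : Fin g ↦ 1) principalType_pos M • W₁ := by
  have ha' : IsAntisymplectic ω₂ ω₁ e.symm.toAddMonoidHom := ha.symm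
  haveI i1 : Finite (graphSubgroup (kerPhiH Φ₁ G₁) (kerPhiH Φ₂ G₂) e.toAddMonoidHom) := hω₁.finite_graphSubgroup hG₁ _
  haveI i2 : Finite (graphSubgroup (kerPhiH Φ₂ G₂) (kerPhiH Φ₁ G₁) e.symm.toAddMonoidHom) :=
    hω₂.finite_graphSubgroup hG₂ _
  have hg' : Fintype.card ι₂ + Fintype.card ι₁ = 2 * g := by rw [add_comm, hg]
  obtain ⟨W, hW, hhW⟩ :=
    exists_isPolarizedIso_prinPeriod_quotientBy_graphSubgroup hω₁ hω₂ hG₁ hG₂ e.bijective ha hg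
  obtain ⟨W', hW', hhW'⟩ :=
    exists_isPolarizedIso_prinPeriod_quotientBy_graphSubgroup hω₂ hω₁ hG₂ hG₁ e.symm.bijective ha' hg'
  exact ⟨ha', i1, i2, W, W', hW, hW', hhW, hhW',
    fun W₁ W₁' h₁ h₁' hh₁ hh₁' ↦ exists_smul_eq_of_isPolarizedIso_swap e hh₁ hh₁'⟩

end Swap

end SiegelModuli

end Literature.AlgebraicGeometry.ModuliOfAbelianVarieties

end
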